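import Summits.ValiantsHypothesis.ValiantsHypothesis.Theses.LangWeilTransfer
import Summits.ValiantsHypothesis.ValiantsHypothesis.Theorems.LangWeilTransferGoodReduction
import Summits.ValiantsHypothesis.ValiantsHypothesis.Theorems.LangWeilTransferTameTransferOfSupports
import Summits.ValiantsHypothesis.ValiantsHypothesis.Theorems.LangWeilTransferTameTransferModelCount
import Summits.ValiantsHypothesis.ValiantsHypothesis.Theorems.LangWeilTransferTameTransferModelPoints

/-!
# LangWeilTransfer — `TameResolution` (stmt-6378), hence `TameTransfer` (stmt-6373), from
# CONGRUENCE MODELS: the conjuncts over `ℚ̄` discharged once and for all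

Route `LangWeilTransfer` of `ValiantsHypothesis`. The support `TameResolution` (the last open
input of the crux `TameTransfer`, Theorem T) asks, for every minimal prime `𝔭` of the `ℚ`-ideal
of an integer system `S`, for a hypersurface model `Q ∈ ℤ[U, T₁..T_r]`, `ρ ∈ ℤ[T]`,
`V : Fin m → ℤ[U, T]`, `cQ ∈ ℤ` with two conjuncts that live over `ℚ̄`:

* (count) `#minimal primes over (Q^ℚ) ℚ̄[U,T] ≤ #minimal primes over 𝔭 ℚ̄[Y]`;
* (points) every `ℚ̄`-zero `x` of `Q` with `ρ(x ∘ succ) ≠ 0` gives the common zero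
  `V(x)/ρ(x ∘ succ)` of `S`;

plus degree / log-weight bounds. This file proves that both `ℚ̄`-conjuncts follow from purely
`ℚ`-rational data that a Kronecker-style construction produces anyway — Noether coordinates
`ℓ : Fin r → ℚ[Y]` algebraically independent modulo `𝔭`, an element `u ∈ ℚ[Y]` with
`Q(u, ℓ) ∈ 𝔭`, and the parametrisation CONGRUENCES `ρ(ℓ)·Y_j - V_j(u, ℓ) ∈ 𝔭`:

* `tameResolution_of_congruenceModels` — **`TameResolution` from the statement `CongruenceModels`**
  spelled out in its hypothesis (same envelope; no algebraic closure, no minimal primes of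
  extended ideals), by `ncard_minimalPrimes_model_le_int` (dominant maps do not increase the
  geometric number of components) and `forall_aeval_div_eq_zero_int` (weighted homogenisation);
* `tameTransfer_of_congruenceModels` — hence Theorem T, by the landed `transferGlue_proof`,
  `langWeilBound_proof`, `goodReduction_proof`.

Honest framing: a reduction of an open support of a conditional route (SE and P^#P ⊄ P/poly stay
open); `CongruenceModels` itself — steps (R)(N)(P) and the height bookkeeping of the resolution —
is NOT proved here. VP ≠ VNP is NOT proved and nothing here bears on it.
-/

noncomputable section

open MvPolynomial Polynomial

-- the summit and the problem share the name `ValiantsHypothesis` (D-0017 single-conjunct layout)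
set_option linter.dupNamespace false

namespace Summit.ValiantsHypothesis.ValiantsHypothesis.Theorems.LangWeilTransfer

open Summit.ValiantsHypothesis.ValiantsHypothesis.Theses.LangWeilTransfer
open Literature.Computability.AlgebraicComplexity (weight)

/-! ## `TameResolution` and Theorem T from congruence models -/

/-- **`TameResolution` from congruence models.** If for every integer system `S` (degrees `≤ d`,
weights `≤ w`, `m` unknowns, `t` equations) and every minimal prime `𝔭` of its `ℚ`-ideal there
are `r ≤ m`, `ℓ : Fin r → ℚ[Y]` algebraically independent modulo `𝔭`, `u ∈ ℚ[Y]`,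
`Q ∈ ℤ[X₀..X_r]` with `(finSuccEquiv ℤ r Q).leadingCoeff = C cQ`, `cQ ≠ 0`, positive `X₀`-degree,
`Q^ℚ` irreducible and `Q(u, ℓ) ∈ 𝔭`, `ρ ∈ ℤ[X₁..X_r] ∖ 0` and `V : Fin m → ℤ[X₀..X_r]` with the
congruences `ρ(ℓ)·Y_j - V_j(u, ℓ) ∈ 𝔭`, all within the degree / log-weight envelope of
`TameResolution` with exponent `a` — then `TameResolution` holds (with the same `a`). -/
theorem tameResolution_of_congruenceModels
    (hmodels : ∃ a : ℕ, ∀ (m t d w : ℕ) (S : Fin t → MvPolynomial (Fin m) ℤ),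
      (∀ i, (S i).totalDegree ≤ d) → (∀ i, weight (S i) ≤ w) →
      ∀ 𝔭 ∈ (Ideal.span (Set.range fun i => MvPolynomial.map (Int.castRingHom ℚ) (S i))).minimalPrimes,
      ∃ (r : ℕ) (ℓ : Fin r → MvPolynomial (Fin m) ℚ) (u : MvPolynomial (Fin m) ℚ)
        (Q : MvPolynomial (Fin (r + 1)) ℤ) (ρ : MvPolynomial (Fin r) ℤ)
        (V : Fin m → MvPolynomial (Fin (r + 1)) ℤ) (cQ : ℤ),
        r ≤ m ∧ cQ ≠ 0 ∧ ρ ≠ 0 ∧ (MvPolynomial.finSuccEquiv ℤ r Q).leadingCoeff = MvPolynomial.C cQ ∧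
        0 < (MvPolynomial.finSuccEquiv ℤ r Q).natDegree ∧
        Irreducible (MvPolynomial.map (Int.castRingHom ℚ) Q) ∧
        AlgebraicIndependent ℚ (fun i => Ideal.Quotient.mk 𝔭 (ℓ i)) ∧
        MvPolynomial.aeval (Fin.cons u ℓ : Fin (r + 1) → MvPolynomial (Fin m) ℚ)
          (MvPolynomial.map (Int.castRingHom ℚ) Q) ∈ 𝔭 ∧
        (∀ j, MvPolynomial.aeval ℓ (MvPolynomial.map (Int.castRingHom ℚ) ρ) * X j -
          MvPolynomial.aeval (Fin.cons u ℓ : Fin (r + 1) → MvPolynomial (Fin m) ℚ)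
            (MvPolynomial.map (Int.castRingHom ℚ) (V j)) ∈ 𝔭) ∧
        Q.totalDegree ≤ (d + 2) ^ (a * (m + 1)) ∧ ρ.totalDegree ≤ (d + 2) ^ (a * (m + 1)) ∧
        (∀ j, (V j).totalDegree ≤ (d + 2) ^ (a * (m + 1))) ∧
        Nat.log 2 (weight Q) ≤ (d + 2) ^ (a * (m + 1)) * (Nat.log 2 w + Nat.log 2 t + 2) ^ a ∧
        Nat.log 2 (weight ρ) ≤ (d + 2) ^ (a * (m + 1)) * (Nat.log 2 w + Nat.log 2 t + 2) ^ a ∧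
        ∀ j, Nat.log 2 (weight (V j)) ≤
          (d + 2) ^ (a * (m + 1)) * (Nat.log 2 w + Nat.log 2 t + 2) ^ a) :
    TameResolution := by
  classical
  obtain ⟨a, ha⟩ := hmodels
  refine ⟨a, fun m t d w S hd hw 𝔭 h𝔭 => ?_⟩
  obtain ⟨r, ℓ, u, Q, ρ, V, cQ, hr, hcQ, hρ, hlc, hdeg, hirr, hind, hroot, hV, hQd, hρd, hVd, hQw,
    hρw, hVw⟩ := ha m t d w S hd hw 𝔭 h𝔭
  haveI : 𝔭.IsPrime := h𝔭.1.1
  have hS : ∀ i, MvPolynomial.map (Int.castRingHom ℚ) (S i) ∈ 𝔭 := fun i =>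
    h𝔭.1.2 (Ideal.subset_span (Set.mem_range_self i))
  exact ⟨r, Q, ρ, V, cQ, hr, hcQ, hρ, hlc, hdeg, hirr,
    ncard_minimalPrimes_model_le_int 𝔭 ℓ u hind Q cQ hcQ hlc hirr hroot,
    forall_aeval_div_eq_zero_int 𝔭 ℓ u hind Q cQ hcQ hlc hirr hroot ρ hρ V hV S hS,
    hQd, hρd, hVd, hQw, hρw, hVw⟩

/-- **Theorem T from congruence models**: the crux `TameTransfer` (stmt-6373) follows from the
congruence-model statement, by the landed `transferGlue_proof`, `langWeilBound_proof`,
`goodReduction_proof` (`tameTransfer_of_goodReduction_of_tameResolution`). Conditional on its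
hypothesis; nothing else. -/
theorem tameTransfer_of_congruenceModels
    (hmodels : ∃ a : ℕ, ∀ (m t d w : ℕ) (S : Fin t → MvPolynomial (Fin m) ℤ),
      (∀ i, (S i).totalDegree ≤ d) → (∀ i, weight (S i) ≤ w) →
      ∀ 𝔭 ∈ (Ideal.span (Set.range fun i => MvPolynomial.map (Int.castRingHom ℚ) (S i))).minimalPrimes,
      ∃ (r : ℕ) (ℓ : Fin r → MvPolynomial (Fin m) ℚ) (u : MvPolynomial (Fin m) ℚ)
        (Q : MvPolynomial (Fin (r + 1)) ℤ) (ρ : MvPolynomial (Fin r) ℤ)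
        (V : Fin m → MvPolynomial (Fin (r + 1)) ℤ) (cQ : ℤ),
        r ≤ m ∧ cQ ≠ 0 ∧ ρ ≠ 0 ∧ (MvPolynomial.finSuccEquiv ℤ r Q).leadingCoeff = MvPolynomial.C cQ ∧
        0 < (MvPolynomial.finSuccEquiv ℤ r Q).natDegree ∧
        Irreducible (MvPolynomial.map (Int.castRingHom ℚ) Q) ∧
        AlgebraicIndependent ℚ (fun i => Ideal.Quotient.mk 𝔭 (ℓ i)) ∧
        MvPolynomial.aeval (Fin.cons u ℓ : Fin (r + 1) → MvPolynomial (Fin m) ℚ)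
          (MvPolynomial.map (Int.castRingHom ℚ) Q) ∈ 𝔭 ∧
        (∀ j, MvPolynomial.aeval ℓ (MvPolynomial.map (Int.castRingHom ℚ) ρ) * X j -
          MvPolynomial.aeval (Fin.cons u ℓ : Fin (r + 1) → MvPolynomial (Fin m) ℚ)
            (MvPolynomial.map (Int.castRingHom ℚ) (V j)) ∈ 𝔭) ∧
        Q.totalDegree ≤ (d + 2) ^ (a * (m + 1)) ∧ ρ.totalDegree ≤ (d + 2) ^ (a * (m + 1)) ∧
        (∀ j, (V j).totalDegree ≤ (d + 2) ^ (a * (m + 1))) ∧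
        Nat.log 2 (weight Q) ≤ (d + 2) ^ (a * (m + 1)) * (Nat.log 2 w + Nat.log 2 t + 2) ^ a ∧
        Nat.log 2 (weight ρ) ≤ (d + 2) ^ (a * (m + 1)) * (Nat.log 2 w + Nat.log 2 t + 2) ^ a ∧
        ∀ j, Nat.log 2 (weight (V j)) ≤
          (d + 2) ^ (a * (m + 1)) * (Nat.log 2 w + Nat.log 2 t + 2) ^ a) :
    TameTransfer :=
  tameTransfer_of_goodReduction_of_tameResolution goodReduction_proof
    (tameResolution_of_congruenceModels hmodels)

end Summit.ValiantsHypothesis.ValiantsHypothesis.Theorems.LangWeilTransfer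

end
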